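import Mathlib.Tactic.Linarith
import Mathlib.Tactic.NormNum
import Mathlib.Tactic.Ring
import Mathlib.Tactic.LinearCombination
import Mathlib.Tactic.IntervalCases
import Mathlib.Data.ZMod.Basic
import HarnessLib

/-!
# The (0,1) cell of the ι-window, XXXI: the product ground `B₁ × B₂`, XVIII — THE CORNER II, (R-rib): the ribbon rows
# (report [XXXI] `H2-ZERO-ONE-31.md`): arithmetic shadows

Family `hodge`, b2b cell `hweil` (helper of item stmt-HodgeConjecture-2524). Report
`run/shared/lean/b2b/hodge-weil/b2b-hweil-pv1-g43/H2-ZERO-ONE-31.md` ([XXXI]): on `X₀ = B₁ × B₂` ((B₁,B₂) a very general pair of genus-2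
Jacobians, `ι = −1`), the corner support `2R = 2V + 2H` (`V = Θ_{κ₁} × B₂`, `H = B₁ × Θ_{κ₂}`, `S = V ∩ H`), and its RIBBON ROWS: corner sheaves whose
V-half is `T = 𝓘_Z·𝓛` (`𝓛` a line bundle on the ribbon threefold `2V`, `Z ⊂ V` a reduced union of rigid product curves `{w} × Θ_{κ′}`, `C₁ × {z}`).
LEMMA PAR (the local index of `𝒪_Z` at a half-period is `0 / ±8` according to the PARITY of the number of branches), LEMMA U (the free `𝔸³` of
ribbon twists; a corner sheaf with such a half has `e₁^ι ≥ 3` unless its gluing group jumps), the class equations of the (rib, red-bundle) and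
(rib, rib) rows and the machine sieve's verdicts ((rib,rib): EMPTY; (rib, red-bundle): balanced numerics only from 22 vertical curves on), and
LEMMA RBN (Brill–Noether on the theta ribbon `C^{(2)} ⊂ J(C)`). HONEST FRAMING: census results inside the ladder's H2 test ((0,1) cell) on the
SPECIAL fourfold `X₀ = B₁ × B₂`; nothing here is a rung; no case of the Hodge conjecture is proved; no statement of [Markman 2025] / [Perry 2026] /
[EdGFS 2025] is used. Every theorem is a def-free arithmetic statement that the report cites at the step named in its docstring; none claims geometry.
-/

-- mandated namespace `Summit.HodgeConjecture.HodgeConjecture.…` (Problem = Summit) trips `linter.dupNamespace`; the lakefile disables it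
-- tree-wide (weak option), restated here so stand-alone elaboration is warning-free too.
set_option linter.dupNamespace false

namespace Summit.HodgeConjecture.HodgeConjecture.WeilTypeLadder

section ProductGroundEighteen

/-- **[XXXI] 2.2 LEMMA PAR (the local index of `𝒪_Z` at a half-period `p = (w, z) ∈ V[2]`).** With `k` vertical branches `{w} × Θ_{κ′}` (a complete
intersection `{x = s = 0, F = 0}` in `X₀`, `F` of parity `(−1)^k`, Koszul: `(1−(−1))(1−(−1))(1−(−1)^k) = 4(1−(−1)^k)`) and `h ∈ {0,1}` horizontal branches
`C₁ × {z}` (`t = 8`), the exact sequence `0 → 𝒪_Z → 𝒪_{Z_v} ⊕ 𝒪_L → k(p) → 0` (`t(k(p)) = 16`) gives `t_p(𝒪_Z) = 4(1−(−1)^k) + 8 − 16` when `h = 1, k ≥ 1`.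
Values: `h = 0`: `0, 8, 0, 8, …`; `h = 1`: `8, 0, −8, 0, −8, …` (`k = 0, 1, 2, …`); so **`t_p(𝒪_Z) = 0` iff `k + h` is even** (checked for `k ≤ 6`, the
maximum: six theta curves pass through a 2-torsion point), and `t_p(𝓘_Z𝓛) = −c_𝓛(p)·t_p(𝒪_Z) ∈ {0, ∓8}`. [`ring` / `simp` after `interval_cases`] -/
theorem pg18_par :
    (∀ k : ℕ, ((1:ℤ) - (-1)) * (1 - (-1)) * (1 - (-1) ^ k) = 4 * (1 - (-1) ^ k)) ∧
    (∀ k : ℕ, (4:ℤ) * (1 - (-1) ^ k) + 8 - 16 = 4 * (1 - (-1) ^ k) - 8) ∧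
    (∀ k : ℕ, k ≤ 6 → (((4:ℤ) * (1 - (-1) ^ k) = 0 ↔ k % 2 = 0) ∧
                       ((if k = 0 then (8:ℤ) else 4 * (1 - (-1) ^ k) - 8) = 0 ↔ k % 2 = 1))) ∧
    (∀ k : ℕ, k ≤ 6 → ((4:ℤ) * (1 - (-1) ^ k) = 0 ∨ (4:ℤ) * (1 - (-1) ^ k) = 8) ∧
                      ((if k = 0 then (8:ℤ) else 4 * (1 - (-1) ^ k) - 8) = 0 ∨ (if k = 0 then (8:ℤ) else 4 * (1 - (-1) ^ k) - 8) = 8 ∨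
                       (if k = 0 then (8:ℤ) else 4 * (1 - (-1) ^ k) - 8) = -8)) := by
  refine ⟨fun k => by ring, fun k => by ring, fun k hk => ?_, fun k hk => ?_⟩
  · interval_cases k <;> simp
  · interval_cases k <;> simp

/-- **[XXXI] 2.3 (the δ-invariant and the class of `𝓘_Z𝓛`).** At a half-period with `k` planar vertical branches and `h` horizontal ones the
δ-invariant is `k(k−1)/2 + h·[k ≥ 1]` (ordinary `k`-fold point `k(k−1)/2`; the transversal branch adds colength `1`): node `(1,1) ↦ 1`, three axes
`(2,1) ↦ 2`, two verticals `(2,0) ↦ 1`; the 'fully nodal' configuration `Z(κ′)` (six verticals `{w} × Θ_{κ′}`, six horizontals at `Θ_{κ′}[2]`, 36 nodes)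
has `(a, b, δ) = (6, 6, 36)` and `χ(𝓛|_Z) = 6(2n−1) + 6(d−1) − 36`; with `d = 3`: `12n − 30`. [`norm_num`] -/
theorem pg18_delta :
    ((1:ℤ) * (1 - 1) / 2 + 1 = 1) ∧ ((2:ℤ) * (2 - 1) / 2 + 1 = 2) ∧ ((2:ℤ) * (2 - 1) / 2 + 0 = 1) ∧ ((6:ℤ) * 6 = 36) ∧
    (∀ n : ℤ, 6 * (2 * n - 1) + 6 * (3 - 1) - 36 = 12 * n - 30) := by
  refine ⟨by norm_num, by norm_num, by norm_num, by norm_num, fun n => by ring⟩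

/-- **[XXXI] 5.1 (the (rib, red-bundle) class equation: elimination).** `ch(𝓘_Z𝓛) + ch(i_{H*}𝓠) = W` with `𝓛|_V` of bidegree `(d, n)`, `Z` of
`a` verticals, `b` horizontals, δ-invariant `δ`, and `𝓠` locally free of rank 2 on `H` with `c₁ = n′θ₁ + d′f′`, `c₂ = m′ϖ′ + μ′f′θ₁` reads (GRR for
`H ⊂ X₀`, `td(N_H)^{−1} = 1 − f′`): `d = 3`, `2n + n′ = 2`, `d′ = 4`, `2n − a + n′² − m′ = 0`, `2n² − b + 3n′ − μ′ = 0`, and in top degree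
`2n² − a(2n−1) − 2b + δ + 3n′² − n′μ′ − m′ = −2`. Eliminating `n′, m′, μ′`: the top-degree equation is EQUIVALENT to
**`δ = 2 − 4n³ + 6n² − 6n + 2n(a + b) − 2a`** (the identity below is `LHS + 2 = δ − RHS` after substitution). [`ring`] -/
theorem pg18_ribred_elimination (n a b δ : ℤ) :
    2 * n ^ 2 - a * (2 * n - 1) - 2 * b + δ + 3 * (2 - 2 * n) ^ 2 - (2 - 2 * n) * (3 * (2 - 2 * n) + 2 * n ^ 2 - b)
      - ((2 - 2 * n) ^ 2 + 2 * n - a) + 2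
    = δ - (2 - 4 * n ^ 3 + 6 * n ^ 2 - 6 * n + 2 * n * (a + b) - 2 * a) := by
  ring

/-- **[XXXI] 5.2 (the sieve's (rib, red-bundle) verdict, arithmetic part).** The eight balanced numerical types found by `ribbon_sieve.py` PART C
satisfy the cubic `δ = 2 − 4n³ + 6n² − 6n + 2n(a+b) − 2a`: `(n, a, b, δ) = (−4, 22, 0, 158)`, `(−5, 34, 0, 274)`, `(−5, 28, 6, 286)`, `(−5, 28, 10, 246)`,
`(−6, 50, 0, 418)`, `(−6, 44, 6, 430)`, `(−6, 42, 8, 434)`, `(−6, 44, 10, 382)`; all have `a ≥ 22` and `n ≤ −4`, hence `n′ = 2 − 2n ≥ 10`. The box check of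
§5.3: `Z(κ′)` alone (`a = b = 6`, `δ = 36`) would need `2n³ − 3n² − 9n + 23 = 0`, impossible for an integer (`n(n+1)` is even, so the left side is odd).
[`norm_num`; parity via `ZMod 2`] -/
theorem pg18_ribred_rows :
    (∀ q : ℤ × ℤ × ℤ × ℤ, q ∈ [((-4:ℤ), (22:ℤ), (0:ℤ), (158:ℤ)), (-5, 34, 0, 274), (-5, 28, 6, 286), (-5, 28, 10, 246),
        (-6, 50, 0, 418), (-6, 44, 6, 430), (-6, 42, 8, 434), (-6, 44, 10, 382)] →
      q.2.2.2 = 2 - 4 * q.1 ^ 3 + 6 * q.1 ^ 2 - 6 * q.1 + 2 * q.1 * (q.2.1 + q.2.2.1) - 2 * q.2.1 ∧ 22 ≤ q.2.1 ∧ q.1 ≤ -4 ∧ 10 ≤ 2 - 2 * q.1) ∧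
    (∀ n : ℤ, 36 = 2 - 4 * n ^ 3 + 6 * n ^ 2 - 6 * n + 2 * n * (6 + 6) - 2 * 6 ↔ 2 * n ^ 3 - 3 * n ^ 2 - 9 * n + 23 = 0) ∧
    (∀ n : ℤ, 2 * n ^ 3 - 3 * n ^ 2 - 9 * n + 23 ≠ 0) := by
  refine ⟨fun q hq => ?_, fun n => ?_, fun n h => ?_⟩
  · simp only [List.mem_cons, List.not_mem_nil, or_false] at hq
    rcases hq with rfl | rfl | rfl | rfl | rfl | rfl | rfl | rfl <;> norm_num
  · constructor <;> intro h <;> linarith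
  · have h2 := congrArg (Int.cast : ℤ → ZMod 2) h
    push_cast at h2
    revert h2
    generalize (n : ZMod 2) = x
    decide +revert

/-- **[XXXI] 5.4 (the (rib, rib) class equations: the linear consequences).** With both halves of ribbon type (`𝓘_Z𝓛` on `2V` of data
`(d, n; a, b; δ)`, `𝓘_{Z′}𝓛′` on `2H` of data `(d′, n′; a′, b′; δ′)`) the class equation reads `d = d′ = 3`, `n + n′ = 1`,
(E1) `2n − a + 2n′² − b′ = 0`, (E2) `2n² − b + 2n′ − a′ = 0`, (E3) `2n² − a(2n−1) − 2b + δ + 2n′² − a′(2n′−1) − 2b′ + δ′ = −2`. From (E1), (E2):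
**`a + b′ = a′ + b = 2(n² − n + 1)`** `∈ {2, 6, 14, 26, 42, 62, 86, …}`; since `a + b′ ≤ 96 + 16 = 112`, `−6 ≤ n ≤ 7`. [`linear_combination` / `nlinarith`] -/
theorem pg18_ribrib_linear :
    (∀ n n' a b a' b' : ℤ, n + n' = 1 → 2 * n - a + 2 * n' ^ 2 - b' = 0 → 2 * n ^ 2 - b + 2 * n' - a' = 0 →
        a + b' = 2 * (n ^ 2 - n + 1) ∧ a' + b = 2 * (n ^ 2 - n + 1)) ∧
    (∀ n : ℤ, n ≤ -7 ∨ 8 ≤ n → 112 < 2 * (n ^ 2 - n + 1)) ∧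
    ((2:ℤ) * ((-1) ^ 2 - (-1) + 1) = 6 ∧ (2:ℤ) * (2 ^ 2 - 2 + 1) = 6 ∧ (2:ℤ) * (0 ^ 2 - 0 + 1) = 2 ∧ (2:ℤ) * (7 ^ 2 - 7 + 1) = 86) := by
  refine ⟨fun n n' a b a' b' h0 h1 h2 => ⟨?_, ?_⟩, fun n hn => ?_, by norm_num⟩
  · have hn' : n' = 1 - n := by linarith
    subst hn'
    linear_combination (-1 : ℤ) * h1
  · have hn' : n' = 1 - n := by linarith
    subst hn'
    linear_combination (-1 : ℤ) * h2
  · rcases hn with h | h <;> nlinarith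

/-- **[XXXI] 5.5 (the unique numeric (rib, rib) survivor and why it dies).** The sieve leaves, up to the V/H mirror, `n = −1` (`n′ = 2`):
V-side `(a, b, δ) = (0, 2, 0)`, H-side `(a′, b′) = (4, 6)`, and then (E3) forces `δ′ = 16`. Balance off `S` puts both V-horizontals inside `S`
(`t = +8` on two full columns of `S[2]`), so the H-half must vanish on four columns, which needs the four H-verticals to be `Θ_{κ₁} × {z} = C₁ × {z}`
against the six H-horizontals `{w} × C₂`, `w ∈ C₁[2]` — `4·6 = 24` nodes: `δ′ = 24 ≠ 16`. EMPTY. [`linarith` / `norm_num`] -/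
theorem pg18_ribrib_survivor :
    (∀ δ' : ℤ, 2 * (-1) ^ 2 - 0 * (2 * (-1) - 1) - 2 * 2 + 0 + 2 * 2 ^ 2 - 4 * (2 * 2 - 1) - 2 * 6 + δ' = -2 ↔ δ' = 16) ∧
    ((0:ℤ) + 6 = 2 * ((-1) ^ 2 - (-1) + 1) ∧ (4:ℤ) + 2 = 2 * ((-1) ^ 2 - (-1) + 1)) ∧
    ((4:ℤ) * 6 = 24 ∧ (24:ℤ) ≠ 16) := by
  refine ⟨fun δ' => ⟨fun h => by linarith, fun h => by subst h; norm_num⟩, by norm_num, by norm_num⟩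

/-- **[XXXI] 3.3 LEMMA U / COROLLARY U (the deformation bookkeeping of a corner sheaf with a ribbon half).** With `T = 𝓘_W𝓛` (free `𝔸³` of ribbon
twists, `dim U = h⁰(C₁, K²) = 3`), `Q = F/T`, `k₀ = dim Ext¹(Q,T)^ι ≥ 1` and `J ∋ 0` the stratum of `U` where this dimension is attained:
`e₁^ι(F) ≥ dim₀ J + k₀ − 1`, and by the filtered-Ext sequence `e₁^ι(F) ≥ (k₀ − 1) + e₁^ι(T) + e₁^ι(Q) − e₂^ι(Q,T)` with `e₁^ι(T) ≥ 3`. Hence: NO JUMP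
(`dim₀ J = 3`) gives `e₁^ι ≥ 3` — never `(0,1)`; a `(0,1)` sheaf needs `k₀ + dim₀ J ≤ 2` and `e₂^ι(Q,T) ≥ k₀ + 1 + e₁^ι(Q)`. [`omega`] -/
theorem pg18_U_bookkeeping :
    ((3:ℤ) = 5 - 2) ∧
    (∀ e k₀ dJ : ℤ, 1 ≤ k₀ → dJ = 3 → dJ + k₀ - 1 ≤ e → 3 ≤ e) ∧
    (∀ e k₀ dJ : ℤ, 1 ≤ k₀ → 0 ≤ dJ → dJ + k₀ - 1 ≤ e → e ≤ 1 → k₀ + dJ ≤ 2) ∧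
    (∀ e k₀ eT eQ e₂ : ℤ, 3 ≤ eT → (k₀ - 1) + eT + eQ - e₂ ≤ e → e ≤ 1 → k₀ + 1 + eQ ≤ e₂) := by
  refine ⟨by norm_num, fun e k₀ dJ h1 h2 h3 => by omega, fun e k₀ dJ h1 h2 h3 h4 => by omega, fun e k₀ eT eQ e₂ h1 h2 h3 => by omega⟩

/-- **[XXXI] 4.2–4.4 LEMMA RBN (Brill–Noether on the theta ribbon `D = C^{(2)} ⊂ J(C)`, `g = 2`): the counts.** For `𝓝` in the `𝔸³`-torsor
`Pic_M(D)`, `h⁰(𝓝) = h⁰(M ⊗ K^{−1}) + (h⁰(M) − rank A(u))`, `A(u) = A₀ + φ(u)` affine in `u ∈ U`. `M = 𝒪`: `h⁰ = 0 + (1 − r)`, `r ∈ {0, 1}`: `1` at ONE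
point (`𝒪_D`), else `0`; `M = K²`: `h⁰ = 2 + (3 − r)`, `r ∈ {0, 1}`: `5` at ONE point (`𝒪_J(2Θ_κ)|_D`), else `4`; `M = K`: `h⁰ = 1 + (2 − r)` with `r ∈ {1, 2}`
only — `h⁰ = 3` would be an extension of the canonical double cover to `D`, obstructed by the pairing of the ribbon class with the INVARIANT cubic
differential (`h⁰(K³) = 5 = 4(−) + 1(+)`): the values are `{1, 2}`, `2` on a smooth affine quadric. The quadric: for `2 × 2` matrices
`A = S + aJ` (`S` symmetric, `J` the standard skew form, `a ≠ 0` the skew invariant of the torsor) `det A = det S + a²`, and `A = 0` is impossible. [`ring` / `linarith`] -/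
theorem pg18_rbn_counts :
    ((0:ℤ) + (1 - 0) = 1 ∧ (0:ℤ) + (1 - 1) = 0) ∧ ((2:ℤ) + (3 - 0) = 5 ∧ (2:ℤ) + (3 - 1) = 4 ∧ (4:ℤ) - 1 + 2 = 5) ∧
    ((1:ℤ) + (2 - 1) = 2 ∧ (1:ℤ) + (2 - 2) = 1 ∧ (∀ r : ℤ, 1 ≤ r → (1:ℤ) + (2 - r) ≠ 3)) ∧ ((4:ℤ) + 1 = 5) ∧
    (∀ p q r a : ℚ, p * r - (q + a) * (q - a) = (p * r - q ^ 2) + a ^ 2) ∧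
    (∀ p q r a : ℚ, a ≠ 0 → ¬ (p = 0 ∧ q + a = 0 ∧ q - a = 0 ∧ r = 0)) := by
  refine ⟨by norm_num, by norm_num, ⟨by norm_num, by norm_num, fun r hr => by omega⟩, by norm_num, fun p q r a => by ring, ?_⟩
  rintro p q r a ha ⟨_, h1, h2, _⟩
  exact ha (by linarith)

/-- **[XXXI] 2.4 (the 𝔽₂ incidence algebra behind the sieve; script-level facts restated as counts).** The `16 × 16` trope/point incidence matrix of the
`16₆` configuration has rank `6` over `𝔽₂` (kernel `2¹⁰ = 1024` subsets; image `2⁶ = 64` realizable parity sets: `1 + 16 + 30 + 16 + 1`), and rank `5` after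
deleting the six columns of one trope (kernel `2¹¹ = 2048`, image `2⁵ = 32`); a configuration balanced off `S` on one side leaves on `S[2]` a support row
equal to a fixed `P ⊂ C₂[2]` or its complement at each of the six `w` (`2048/1024 = 2` classes). [`norm_num`] -/
theorem pg18_incidence_counts :
    ((2:ℕ) ^ (16 - 6) = 1024 ∧ (2:ℕ) ^ 6 = 64 ∧ 1 + 16 + 30 + 16 + 1 = 64) ∧
    ((2:ℕ) ^ (16 - 5) = 2048 ∧ (2:ℕ) ^ 5 = 32 ∧ 2048 / 1024 = 2) ∧
    ((16:ℕ) * 6 = 96 ∧ 6 * 6 = 36 ∧ 96 - 36 = 60 ∧ 16 * 6 / 6 = 16) := by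
  norm_num

end ProductGroundEighteen

end Summit.HodgeConjecture.HodgeConjecture.WeilTypeLadder
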